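import Literature.Probability.Percolation.QuadLowestCrossingProofs
import Literature.Probability.Percolation.QuadCrossingNullFrontier
import Literature.Probability.Percolation.QuadCrossingContinuityEventsProofs
import HarnessLib

/-!
# Schramm–Smirnov's Lemma 5.1 for bond-`ℤ²`: the four-move assembly

Topic `Probability/Percolation`; proofs only (no named fact is introduced).  Towards the discharge of
the named fact `QuadCrossing.SchrammSmirnov2011_lemma_5_1` (`QuadCrossingContinuityEvents.lean`;
O. Schramm, S. Smirnov, *On the scaling limits of planar percolation*, Ann. Probab. 39 (2011)
1768–1814, arXiv:1101.5820, Lemma 5.1: every subsequential scaling limit of critical bond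
percolation on `δℤ²` gives the boundary of every crossing event `⊞_Q` measure zero).

**What this file proves.**  `schrammSmirnov2011_lemma_5_1_of_chartMoves`: Lemma 5.1 follows from
four elementary statements about CHARTED RECTANGLES `H([a,b] × [c,d])`, `H : ℂ ≃ₜ ℂ` an arbitrary
homeomorphism of the plane (wild quads included):

* (A) a Schramm–Smirnov crossing of the chart quad `rectQuad H a b = H ∘ rectMap a b` inside the
  drawn open edges of `δℤ²` is a `SSContinuity.ChartCrossed H (-a) a (-b) b δ ω` witness;
* (B) conversely a `ChartCrossed H (-a) a c d δ ω` witness with `[c,d] ⊆ [-b,b]` is such a crossing;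
* (C) Lemma 6.1 case (2) moving the LEFT side of a charted rectangle, with constants (the mirror
  image of the landed `SSContinuity.exists_move_bound`);
* (D) Lemma 6.1 case (3) moving the BOTTOM side, with constants (the mirror image of the landed
  `SSContinuity.exists_topMove_bound`).

Given these, the printed proof of Lemma 5.1 (§5, p. 21: "`Q' := Q^{q_{-δ₀/2}} < Q₀ < Q'' := Q^{q_{δ₀/2}}`
… the right-hand side being small by Lemma 6.1") is assembled as follows.  Read `Q₀ ∈ 𝒬_D` through a
homeomorphism `H` of the plane extending it (`Quad.exists_homeomorph_extend`: `Q₀ = H ∘ rectMap 1 1`),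
take room `τ` in `D` (`Quad.exists_rect_near`) and `0 < s ≤ τ` below the four thresholds `Δ₀` of the
moves (top: `exists_topMove_bound H`; bottom: (D); right: `exists_move_bound H`; left: (C); each at
`ε/4`), and put `Q' = rectQuad H (1-s) (1+s)`, `Q'' = rectQuad H (1+s) (1-s)`; then `Q' < Q₀ < Q''`
(`Quad.strictlyDominated_rectQuad`).  On the event "`Q'` crossed, `Q''` not crossed" one of four moves
fails — THE FOUR-MOVE CHAIN
`[-(1-s),1-s]×[-(1+s),1+s] →(top down by 3s, sides in and bottom down by s/2)→ →(bottom up by 3s, sides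
in and top up by s/2)→ [-(1-2s),1-2s]×[-(1-3s/2),1-3s/2] →(right out by 3s)→ →(left out by 3s)→
[-(1+s),1+s]×[-(1-3s/2),1-3s/2]`, whose first event is implied by a crossing of `Q'` (A) and whose
last event gives a crossing of `Q''` (B, as `1-3s/2 ≤ 1-s`) —, so the union bound and
`SchrammSmirnov2011_lemma_5_1_of_continuity` (`QuadCrossingContinuityEventsProofs.lean`, the whole of
§5) conclude.  The discharge `SchrammSmirnov2011_lemma_5_1_holds` is the instance of this theorem at
the four chart lemmas, in the sequel file `QuadCrossingContinuityEventsDischarge.lean`.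

## References

* O. Schramm, S. Smirnov, Ann. Probab. 39 (2011) 1768–1814, arXiv:1101.5820: Lemma 5.1 and its
  proof (§5, p. 21), Lemma 6.1 (§6). [SchrammSmirnov2011]
-/

noncomputable section

open Set Metric Filter Complex
open _root_.MeasureTheory _root_.Topology
open scoped ENNReal unitInterval
open Literature.Probability.LatticeModels

namespace Literature.Probability.Percolation

namespace QuadCrossing

/-- A translate by `0` of a chart is the chart. [folklore] -/
theorem homeomorph_trans_addRight_zero (H : ℂ ≃ₜ ℂ) : H.trans (Homeomorph.addRight (0 : ℂ)) = H :=
  Homeomorph.ext fun u => by simp [Homeomorph.trans_apply]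

/-- Union bound for the four-move chain: if `E₀ ω` holds and `E₄ ω` fails then one of the four
consecutive moves `Eᵢ ∧ ¬ Eᵢ₊₁` fails. [folklore] -/
theorem setOf_and_not_subset_union4 {Ω : Type*} (E₀ E₁ E₂ E₃ E₄ : Ω → Prop) :
    {ω | E₀ ω ∧ ¬ E₄ ω} ⊆
      ((({ω | E₀ ω ∧ ¬ E₁ ω} ∪ {ω | E₁ ω ∧ ¬ E₂ ω}) ∪ {ω | E₂ ω ∧ ¬ E₃ ω}) ∪ {ω | E₃ ω ∧ ¬ E₄ ω}) := by
  rintro ω ⟨h0, h4⟩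
  by_cases h1 : E₁ ω
  · by_cases h2 : E₂ ω
    · by_cases h3 : E₃ ω
      · exact Or.inr ⟨h3, h4⟩
      · exact Or.inl (Or.inr ⟨h2, h3⟩)
    · exact Or.inl (Or.inl (Or.inr ⟨h1, h2⟩))
  · exact Or.inl (Or.inl (Or.inl ⟨h0, h1⟩))

/-- **Schramm–Smirnov's Lemma 5.1 for critical bond percolation on `δℤ²`, from the four chart
statements (A)–(D) of the module docstring** (the four-move chain; see there).
[cite: SchrammSmirnov2011, Lemma 5.1 (proof, §5 p. 21); Lemma 6.1] -/
theorem schrammSmirnov2011_lemma_5_1_of_chartMoves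
    (hA : ∀ {D : Set ℂ} (H : ℂ ≃ₜ ℂ) (a b : ℝ) (ha : 0 < a) (hb : 0 < b)
      (hD : ∀ p : I × I, H (Quad.rectMap a b p) ∈ D) (δ : ℝ) (ω : BondConfig (Site 2)) (K : Set ℂ),
      (Quad.rectQuad H a b ha hb hD).IsCrossing K → K ⊆ openEdgeUnion δ ω →
        SSContinuity.ChartCrossed H (-a) a (-b) b δ ω)
    (hB : ∀ {D : Set ℂ} (H : ℂ ≃ₜ ℂ) (a b : ℝ) (ha : 0 < a) (hb : 0 < b)
      (hD : ∀ p : I × I, H (Quad.rectMap a b p) ∈ D) (c d δ : ℝ) (ω : BondConfig (Site 2)),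
      -b ≤ c → d ≤ b → SSContinuity.ChartCrossed H (-a) a c d δ ω →
        ∃ K : Set ℂ, (Quad.rectQuad H a b ha hb hD).IsCrossing K ∧ K ⊆ openEdgeUnion δ ω)
    (hC : ∀ (H : ℂ ≃ₜ ℂ) {ε : ℝ}, 0 < ε →
      ∃ Δ₀ : ℝ, 0 < Δ₀ ∧ ∀ Δ : ℝ, 0 < Δ → Δ ≤ Δ₀ → ∃ δ₀ : ℝ, 0 < δ₀ ∧ ∀ δ : ℝ, 0 < δ → δ < δ₀ →
        ∀ a b c d : ℝ, -2 ≤ a - Δ → 1 ≤ b - a → b ≤ 2 → -2 + 1 / 8 ≤ c → 1 ≤ d - c → d ≤ 2 →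
          bondPercolation (zdGraph 2) half
            {ω | SSContinuity.ChartCrossed H a b c d δ ω ∧
              ¬ SSContinuity.ChartCrossed H (a - Δ) b c d δ ω} ≤ ENNReal.ofReal ε)
    (hDm : ∀ (H : ℂ ≃ₜ ℂ) {ε : ℝ}, 0 < ε →
      ∃ Δ₀ : ℝ, 0 < Δ₀ ∧ ∀ Δt κ : ℝ, 0 < Δt → 0 < κ → Δt + κ ≤ Δ₀ → ∃ δ₀ : ℝ, 0 < δ₀ ∧
        ∀ δ : ℝ, 0 < δ → δ < δ₀ → ∀ a b c d : ℝ, -7 / 4 ≤ a → b ≤ 7 / 4 → 3 / 2 ≤ b - a →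
          -7 / 4 ≤ c → d ≤ 7 / 4 → 3 / 2 ≤ d - c →
            bondPercolation (zdGraph 2) half
              {ω | SSContinuity.ChartCrossed H a b c d δ ω ∧
                ¬ SSContinuity.ChartCrossed H (a + κ) (b - κ) (c + Δt) (d + κ) δ ω} ≤
              ENNReal.ofReal ε) :
    SchrammSmirnov2011_lemma_5_1 := by
  refine SchrammSmirnov2011_lemma_5_1_of_continuity fun D hD _hne Q₀ ε hε => ?_
  -- a real budget `εr ∈ (0, 1]` with `ofReal εr ≤ ε`, split in four
  set ε₁ : ℝ≥0∞ := min ε 1 with hε₁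
  have hε₁top : ε₁ ≠ ⊤ := ne_top_of_le_ne_top ENNReal.one_ne_top (min_le_right _ _)
  have hε₁pos : 0 < ε₁ := lt_min hε zero_lt_one
  set εr : ℝ := ε₁.toReal with hεr_def
  have hεr : 0 < εr := ENNReal.toReal_pos hε₁pos.ne' hε₁top
  have hεq : 0 < εr / 4 := by positivity
  -- the chart `H` of `Q₀` and room in `D`
  obtain ⟨H, hH'⟩ := Quad.exists_homeomorph_extend Q₀
  have hH : ∀ p : I × I, H (Quad.rectMap 1 1 p) = Q₀ p := fun p => by
    rw [Quad.rectMap_one_one]; exact hH' p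
  obtain ⟨τ, hτ, hτ2, hroom⟩ := Quad.exists_rect_near hD Q₀ H hH one_pos
  -- the four thresholds
  obtain ⟨Δ₁, hΔ₁, h1⟩ := SSContinuity.exists_topMove_bound H hεq
  obtain ⟨Δ₂, hΔ₂, h2⟩ := hDm H hεq
  obtain ⟨Δ₃, hΔ₃, h3⟩ := SSContinuity.exists_move_bound H hεq
  obtain ⟨Δ₄, hΔ₄, h4⟩ := hC H hεq
  -- the size `s` of the perturbation
  set s : ℝ := min (min τ (1 / 16)) (min (min Δ₁ Δ₂) (min Δ₃ Δ₄)) / 4 with hs_def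
  have hs : 0 < s := by
    rw [hs_def]
    have : 0 < min (min τ (1 / 16)) (min (min Δ₁ Δ₂) (min Δ₃ Δ₄)) :=
      lt_min (lt_min hτ (by norm_num)) (lt_min (lt_min hΔ₁ hΔ₂) (lt_min hΔ₃ hΔ₄))
    positivity
  have hmin₁ : min (min τ (1 / 16)) (min (min Δ₁ Δ₂) (min Δ₃ Δ₄)) ≤ τ :=
    (min_le_left _ _).trans (min_le_left _ _)
  have hmin₂ : min (min τ (1 / 16)) (min (min Δ₁ Δ₂) (min Δ₃ Δ₄)) ≤ 1 / 16 :=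
    (min_le_left _ _).trans (min_le_right _ _)
  have hmin₃ : min (min τ (1 / 16)) (min (min Δ₁ Δ₂) (min Δ₃ Δ₄)) ≤ Δ₁ :=
    (min_le_right _ _).trans ((min_le_left _ _).trans (min_le_left _ _))
  have hmin₄ : min (min τ (1 / 16)) (min (min Δ₁ Δ₂) (min Δ₃ Δ₄)) ≤ Δ₂ :=
    (min_le_right _ _).trans ((min_le_left _ _).trans (min_le_right _ _))
  have hmin₅ : min (min τ (1 / 16)) (min (min Δ₁ Δ₂) (min Δ₃ Δ₄)) ≤ Δ₃ :=
    (min_le_right _ _).trans ((min_le_right _ _).trans (min_le_left _ _))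
  have hmin₆ : min (min τ (1 / 16)) (min (min Δ₁ Δ₂) (min Δ₃ Δ₄)) ≤ Δ₄ :=
    (min_le_right _ _).trans ((min_le_right _ _).trans (min_le_right _ _))
  have hsτ : s ≤ τ := by rw [hs_def]; linarith
  have hs16 : s ≤ 1 / 64 := by rw [hs_def]; linarith
  have hsΔ₁ : 3 * s + s / 2 ≤ Δ₁ := by rw [hs_def]; linarith
  have hsΔ₂ : 3 * s + s / 2 ≤ Δ₂ := by rw [hs_def]; linarith
  have hsΔ₃ : 3 * s ≤ Δ₃ := by rw [hs_def]; linarith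
  have hsΔ₄ : 3 * s ≤ Δ₄ := by rw [hs_def]; linarith
  -- the four mesh thresholds
  obtain ⟨δ₁, hδ₁, h1'⟩ := h1 (3 * s) (s / 2) (by positivity) (by positivity) hsΔ₁
  obtain ⟨δ₂, hδ₂, h2'⟩ := h2 (3 * s) (s / 2) (by positivity) (by positivity) hsΔ₂
  obtain ⟨δ₃, hδ₃, h3'⟩ := h3 (3 * s) (by positivity) hsΔ₃
  obtain ⟨δ₄, hδ₄, h4'⟩ := h4 (3 * s) (by positivity) hsΔ₄
  -- the quads `Q' < Q₀ < Q''`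
  have habs₁ : |1 - s - 1| ≤ τ := by
    rw [show (1 : ℝ) - s - 1 = -s by ring, abs_neg, abs_of_pos hs]; exact hsτ
  have habs₂ : |1 + s - 1| ≤ τ := by
    rw [show (1 : ℝ) + s - 1 = s by ring, abs_of_pos hs]; exact hsτ
  have habs₀ : |(1 : ℝ) - 1| ≤ τ := by rw [sub_self, abs_zero]; exact hτ.le
  have hD' : ∀ p : I × I, H (Quad.rectMap (1 - s) (1 + s) p) ∈ D := (hroom _ _ habs₁ habs₂).1
  have hD'' : ∀ p : I × I, H (Quad.rectMap (1 + s) (1 - s) p) ∈ D := (hroom _ _ habs₂ habs₁).1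
  have hD₀ : ∀ p : I × I, H (Quad.rectMap 1 1 p) ∈ D := (hroom _ _ habs₀ habs₀).1
  have h1s : (0 : ℝ) < 1 - s := by linarith
  have h1s' : (0 : ℝ) < 1 + s := by linarith
  have hlt : (1 : ℝ) - s < 1 := by linarith
  have hlt' : (1 : ℝ) < 1 + s := by linarith
  set Q' : Quad D := Quad.rectQuad H (1 - s) (1 + s) h1s h1s' hD' with hQ'_def
  set Q'' : Quad D := Quad.rectQuad H (1 + s) (1 - s) h1s' h1s hD'' with hQ''_def
  have hQ₀ : Quad.rectQuad H 1 1 one_pos one_pos hD₀ = Q₀ := Quad.ext fun p => hH p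
  have hdom' : Quad.StrictlyDominated Q' Q₀ := by
    have := Quad.strictlyDominated_rectQuad H (a₁ := 1 - s) (a₂ := 1) (b₁ := 1 + s) (b₂ := 1)
      h1s hlt one_pos hlt' hD' hD₀
    rwa [hQ₀] at this
  have hdom'' : Quad.StrictlyDominated Q₀ Q'' := by
    have := Quad.strictlyDominated_rectQuad H (a₁ := 1) (a₂ := 1 + s) (b₁ := 1) (b₂ := 1 - s)
      one_pos hlt' h1s hlt hD₀ hD''
    rwa [hQ₀] at this
  refine ⟨Q', Q'', hdom', hdom'', min (min δ₁ δ₂) (min δ₃ δ₄),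
    lt_min (lt_min hδ₁ hδ₂) (lt_min hδ₃ hδ₄), fun δ hδ hδδ₀ => ?_⟩
  have hδδ₁ : δ < δ₁ := hδδ₀.trans_le ((min_le_left _ _).trans (min_le_left _ _))
  have hδδ₂ : δ < δ₂ := hδδ₀.trans_le ((min_le_left _ _).trans (min_le_right _ _))
  have hδδ₃ : δ < δ₃ := hδδ₀.trans_le ((min_le_right _ _).trans (min_le_left _ _))
  have hδδ₄ : δ < δ₄ := hδδ₀.trans_le ((min_le_right _ _).trans (min_le_right _ _))
  -- the five events of the chain (corner coordinates)
  set a₀ : ℝ := -(1 - s) with ha₀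
  set b₀ : ℝ := 1 - s with hb₀
  set c₀ : ℝ := -(1 + s) with hc₀
  set d₀ : ℝ := 1 + s with hd₀
  set a₁ : ℝ := a₀ + s / 2 with ha₁
  set b₁ : ℝ := b₀ - s / 2 with hb₁
  set c₁ : ℝ := c₀ - s / 2 with hc₁
  set d₁ : ℝ := d₀ - 3 * s with hd₁
  set a₂ : ℝ := a₁ + s / 2 with ha₂
  set b₂ : ℝ := b₁ - s / 2 with hb₂
  set c₂ : ℝ := c₁ + 3 * s with hc₂
  set d₂ : ℝ := d₁ + s / 2 with hd₂
  let E₀ : BondConfig (Site 2) → Prop := fun ω => SSContinuity.ChartCrossed H a₀ b₀ c₀ d₀ δ ω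
  let E₁ : BondConfig (Site 2) → Prop := fun ω => SSContinuity.ChartCrossed H a₁ b₁ c₁ d₁ δ ω
  let E₂ : BondConfig (Site 2) → Prop := fun ω => SSContinuity.ChartCrossed H a₂ b₂ c₂ d₂ δ ω
  let E₃ : BondConfig (Site 2) → Prop := fun ω =>
    SSContinuity.ChartCrossed H a₂ (b₂ + 3 * s) c₂ d₂ δ ω
  let E₄ : BondConfig (Site 2) → Prop := fun ω =>
    SSContinuity.ChartCrossed H (a₂ - 3 * s) (b₂ + 3 * s) c₂ d₂ δ ω
  -- the four one-move bounds
  have hP₁ : bondPercolation (zdGraph 2) half {ω | E₀ ω ∧ ¬ E₁ ω} ≤ ENNReal.ofReal (εr / 4) :=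
    h1' δ hδ hδδ₁ a₀ b₀ c₀ d₀ (by rw [ha₀]; linarith) (by rw [hb₀]; linarith)
      (by rw [ha₀, hb₀]; linarith) (by rw [hc₀]; linarith) (by rw [hd₀]; linarith)
      (by rw [hc₀, hd₀]; linarith)
  have hP₂ : bondPercolation (zdGraph 2) half {ω | E₁ ω ∧ ¬ E₂ ω} ≤ ENNReal.ofReal (εr / 4) :=
    h2' δ hδ hδδ₂ a₁ b₁ c₁ d₁ (by rw [ha₁, ha₀]; linarith) (by rw [hb₁, hb₀]; linarith)
      (by rw [ha₁, hb₁, ha₀, hb₀]; linarith) (by rw [hc₁, hc₀]; linarith)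
      (by rw [hd₁, hd₀]; linarith) (by rw [hc₁, hd₁, hc₀, hd₀]; linarith)
  have hP₃ : bondPercolation (zdGraph 2) half {ω | E₂ ω ∧ ¬ E₃ ω} ≤ ENNReal.ofReal (εr / 4) := by
    have := h3' δ hδ hδδ₃ 0 (by simp) a₂ b₂ c₂ d₂ (by rw [ha₂, ha₁, ha₀]; linarith)
      (by rw [ha₂, hb₂, ha₁, hb₁, ha₀, hb₀]; linarith) (by rw [hb₂, hb₁, hb₀]; linarith)
      (by rw [hc₂, hc₁, hc₀]; linarith) (by rw [hc₂, hd₂, hc₁, hd₁, hc₀, hd₀]; linarith)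
      (by rw [hd₂, hd₁, hd₀]; linarith)
    rwa [homeomorph_trans_addRight_zero] at this
  have hP₄ : bondPercolation (zdGraph 2) half {ω | E₃ ω ∧ ¬ E₄ ω} ≤ ENNReal.ofReal (εr / 4) :=
    h4' δ hδ hδδ₄ a₂ (b₂ + 3 * s) c₂ d₂ (by rw [ha₂, ha₁, ha₀]; linarith)
      (by rw [ha₂, hb₂, ha₁, hb₁, ha₀, hb₀]; linarith) (by rw [hb₂, hb₁, hb₀]; linarith)
      (by rw [hc₂, hc₁, hc₀]; linarith) (by rw [hc₂, hd₂, hc₁, hd₁, hc₀, hd₀]; linarith)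
      (by rw [hd₂, hd₁, hd₀]; linarith)
  -- the two ends of the chain
  have hstart : ∀ ω, (∃ K, Q'.IsCrossing K ∧ K ⊆ openEdgeUnion δ ω) → E₀ ω := by
    rintro ω ⟨K, hK, hKU⟩
    exact hA H (1 - s) (1 + s) h1s h1s' hD' δ ω K hK hKU
  have hend : ∀ ω, E₄ ω → ∃ K, Q''.IsCrossing K ∧ K ⊆ openEdgeUnion δ ω := by
    intro ω hω
    have e₁ : a₂ - 3 * s = -(1 + s) := by rw [ha₂, ha₁, ha₀]; ring
    have e₂ : b₂ + 3 * s = 1 + s := by rw [hb₂, hb₁, hb₀]; ring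
    have hω' : SSContinuity.ChartCrossed H (-(1 + s)) (1 + s) c₂ d₂ δ ω := by
      have hω'' : SSContinuity.ChartCrossed H (a₂ - 3 * s) (b₂ + 3 * s) c₂ d₂ δ ω := hω
      rwa [e₁, e₂] at hω''
    exact hB H (1 + s) (1 - s) h1s' h1s hD'' c₂ d₂ δ ω (by rw [hc₂, hc₁, hc₀]; linarith)
      (by rw [hd₂, hd₁, hd₀]; linarith) hω'
  -- union bound
  have hsub : {ω | (∃ K, Q'.IsCrossing K ∧ K ⊆ openEdgeUnion δ ω) ∧
      ¬ ∃ K, Q''.IsCrossing K ∧ K ⊆ openEdgeUnion δ ω} ⊆ {ω | E₀ ω ∧ ¬ E₄ ω} := by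
    rintro ω ⟨hω₁, hω₂⟩
    exact ⟨hstart ω hω₁, fun h => hω₂ (hend ω h)⟩
  have hofReal : ENNReal.ofReal εr ≤ ε := by
    rw [hεr_def, ENNReal.ofReal_toReal hε₁top]; exact min_le_left _ _
  calc bondPercolation (zdGraph 2) half
        {ω | (∃ K, Q'.IsCrossing K ∧ K ⊆ openEdgeUnion δ ω) ∧
          ¬ ∃ K, Q''.IsCrossing K ∧ K ⊆ openEdgeUnion δ ω}
      ≤ bondPercolation (zdGraph 2) half {ω | E₀ ω ∧ ¬ E₄ ω} := measure_mono hsub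
    _ ≤ bondPercolation (zdGraph 2) half
        (((({ω | E₀ ω ∧ ¬ E₁ ω} ∪ {ω | E₁ ω ∧ ¬ E₂ ω}) ∪ {ω | E₂ ω ∧ ¬ E₃ ω}) ∪
          {ω | E₃ ω ∧ ¬ E₄ ω})) := measure_mono (setOf_and_not_subset_union4 E₀ E₁ E₂ E₃ E₄)
    _ ≤ bondPercolation (zdGraph 2) half {ω | E₀ ω ∧ ¬ E₁ ω} +
          bondPercolation (zdGraph 2) half {ω | E₁ ω ∧ ¬ E₂ ω} +
          bondPercolation (zdGraph 2) half {ω | E₂ ω ∧ ¬ E₃ ω} +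
          bondPercolation (zdGraph 2) half {ω | E₃ ω ∧ ¬ E₄ ω} := by
        refine (measure_union_le _ _).trans ?_
        refine add_le_add ((measure_union_le _ _).trans ?_) le_rfl
        exact add_le_add ((measure_union_le _ _).trans le_rfl) le_rfl
    _ ≤ ENNReal.ofReal (εr / 4) + ENNReal.ofReal (εr / 4) + ENNReal.ofReal (εr / 4) +
          ENNReal.ofReal (εr / 4) := by gcongr
    _ = ENNReal.ofReal εr := by
        rw [← ENNReal.ofReal_add (by positivity) (by positivity),
          ← ENNReal.ofReal_add (by positivity) (by positivity),
          ← ENNReal.ofReal_add (by positivity) (by positivity)]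
        congr 1; ring
    _ ≤ ε := hofReal

end QuadCrossing

end Literature.Probability.Percolation

end
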